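import Mathlib
import Literature.Analysis.FluidPDE.LocalTypeIProofs
import Summits.NavierStokesRegularity.NavierStokesRegularity.Theorems.EulerZoomLiouvilleSereginZoomReductionVelocityCompactness
import Summits.NavierStokesRegularity.NavierStokesRegularity.Theorems.EulerZoomLiouvilleSereginZoomReductionVanishingViscosityStability
import HarnessLib

/-!
# Compactness of suitable weak Navier–Stokes solutions with VANISHING viscosities on one parabolic
# cylinder `Q(0, R)` (support item `EulerZoomLiouville.SereginZoomReduction` = stmt-NavierStokesRegularity-19834)

Route `EulerZoomLiouville` (NavierStokesRegularity), support item Z = Seregin's Euler-zoom theorem (Seregin 2026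
Thm 3.1 = Seregin 2023 Prop 1.2 at `(s,l,κ) = (3,3,2)`, `f(r) = r^ρ`).  The analogue, for viscosities
`0 ≤ ν_k ≤ 1`, `ν_k → 0`, and on the FULL cylinder `Q(0,R)` (the uniform bounds are hypotheses, so no interior
loss), of the tree's compactness theorem `SuitableCompactness_holds` (Albritton–Barker 2019 Lemma 2.2 after
Lin 1998 Thm 2.2):

* `cylinder_compactness_vanishingViscosity` — suitable weak solutions `(V_k, P_k)` on `Q(0,R)` with viscosities
  `ν_k`, weak gradients `G_k`, and uniform bounds `∫_{B_R} |V_k(t)|² ≤ C` (a.e. `t`), `∫_{Q(R)} |G_k|² ≤ C`,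
  `∫_{Q(R)} |P_k|^{3/2} ≤ M_p` have a subsequence along which `V_{σ j} → u` in `L³(Q(R))`, `P_{σ j} ⇀ p` weakly
  in `L^{3/2}(Q(R))`, with `(u, p)` a suitable weak solution of the EULER system on `Q(0,R)` obeying the same
  three bounds (velocities: `exists_subseq_strong_limit_velocity_visc_ball`; pressures:
  `exists_subseq_tendsto_integral_mul_of_lintegral_rpow_le'`; `L^{10/3}` ⇒ `L³`:
  `SuitableCompactness.exists_tenThirds_bound`; gradient of the limit:
  `exists_hasWeakSpatialGradientOn_of_weakGradient_approx_L2`; suitability: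
  `isSuitableWeakSolutionOn_of_tendsto_vanishingViscosity`).

WHAT THIS IS NOT: not NS regularity, not the crux; a helper `--supports` stmt-19834. [folklore]
-/

noncomputable section

set_option linter.dupNamespace false

open MeasureTheory TopologicalSpace Set Function Filter Topology Metric Bornology
open scoped NNReal ENNReal InnerProductSpace RealInnerProductSpace

namespace Summit.NavierStokesRegularity.NavierStokesRegularity.Theorems.SereginZoomReduction

open Literature.Analysis Literature.Analysis.FluidPDE Literature.Analysis.FunctionSpaces

/-- **Compactness on one cylinder with vanishing viscosities.**  Let `(V_k, P_k)` be suitable weak solutions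
of Navier–Stokes (viscosity `ν_k ∈ [0,1]`, `ν_k → 0`, no force) on `Q(0, R)` with weak spatial gradients `G_k`
and, uniformly in `k`, `∫_{B(0,R)} |V_k(t)|² ≤ C` for a.e. `t ∈ (−R², 0)`, `∫_{Q(0,R)} |G_k|² ≤ C`,
`∫_{Q(0,R)} |P_k|^{3/2} ≤ M_p`.  Then along a subsequence `σ`: `V_{σ j} → u` in `L³(Q(0,R))` and
`P_{σ j} ⇀ p` weakly in `L^{3/2}(Q(0,R))` (tested against `L³`), where `(u, p)` is a suitable weak EULER
solution on `Q(0,R)` (`IsSuitableWeakSolutionOn … 0 0 u p`), `u ∈ L³(Q(0,R))` is jointly measurable with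
`∫_{B(0,R)} |u(t)|² ≤ C` for a.e. `t`, some weak gradient `Gu` of `u` on `Q(0,R)` has `∫ |Gu|² ≤ C`, and
`∫_{Q(0,R)} |p|^{3/2} ≤ M_p`. [folklore] -/
theorem cylinder_compactness_vanishingViscosity {R : ℝ} (hR : 0 < R)
    {ν : ℕ → ℝ} (hν0 : ∀ k, 0 ≤ ν k) (hν1 : ∀ k, ν k ≤ 1) (hνlim : Tendsto ν atTop (𝓝 0))
    {V : ℕ → ℝ → (EuclideanSpace ℝ (Fin 3)) → (EuclideanSpace ℝ (Fin 3))}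
    {P : ℕ → ℝ → (EuclideanSpace ℝ (Fin 3)) → ℝ}
    {GV : ℕ → ℝ → (EuclideanSpace ℝ (Fin 3)) → (EuclideanSpace ℝ (Fin 3)) →L[ℝ] (EuclideanSpace ℝ (Fin 3))}
    {C : ℝ≥0} {Mp : ℝ≥0∞} (hMp : Mp ≠ ∞)
    (hsw : ∀ k, IsSuitableWeakSolutionOn
      (parabolicCylinderOpens R (0 : ℝ × (EuclideanSpace ℝ (Fin 3)))) (ν k) 0 (V k) (P k))
    (hG : ∀ k, HasWeakSpatialGradientOn
      (parabolicCylinderOpens R (0 : ℝ × (EuclideanSpace ℝ (Fin 3)))) (V k) (GV k))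
    (hE : ∀ k, ∀ᵐ t ∂(volume.restrict (Ioo (-R ^ 2) 0)),
      ∫⁻ x in ball (0 : (EuclideanSpace ℝ (Fin 3))) R, ‖V k t x‖ₑ ^ 2 ≤ C)
    (hGb : ∀ k, ∫⁻ z in parabolicCylinder R (0 : ℝ × (EuclideanSpace ℝ (Fin 3))),
      ENNReal.ofReal (frobeniusNormSq (GV k z.1 z.2)) ≤ C)
    (hPb : ∀ k, ∫⁻ z in parabolicCylinder R (0 : ℝ × (EuclideanSpace ℝ (Fin 3))),
      ‖P k z.1 z.2‖ₑ ^ (3 / 2 : ℝ) ≤ Mp) :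
    ∃ (σ : ℕ → ℕ) (u : ℝ → (EuclideanSpace ℝ (Fin 3)) → (EuclideanSpace ℝ (Fin 3)))
      (p : ℝ → (EuclideanSpace ℝ (Fin 3)) → ℝ), StrictMono σ ∧
      IsSuitableWeakSolutionOn (parabolicCylinderOpens R (0 : ℝ × (EuclideanSpace ℝ (Fin 3)))) 0 0 u p ∧
      AEStronglyMeasurable (uncurry u)
        (volume.restrict (parabolicCylinder R (0 : ℝ × (EuclideanSpace ℝ (Fin 3))))) ∧
      MemLp (uncurry u) 3 (volume.restrict (parabolicCylinder R (0 : ℝ × (EuclideanSpace ℝ (Fin 3))))) ∧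
      (∀ᵐ t ∂(volume.restrict (Ioo (-R ^ 2) 0)),
        ∫⁻ x in ball (0 : (EuclideanSpace ℝ (Fin 3))) R, ‖u t x‖ₑ ^ 2 ≤ C) ∧
      (∃ Gu : ℝ → (EuclideanSpace ℝ (Fin 3)) → (EuclideanSpace ℝ (Fin 3)) →L[ℝ] (EuclideanSpace ℝ (Fin 3)),
        HasWeakSpatialGradientOn (parabolicCylinderOpens R (0 : ℝ × (EuclideanSpace ℝ (Fin 3)))) u Gu ∧
        ∫⁻ z in parabolicCylinder R (0 : ℝ × (EuclideanSpace ℝ (Fin 3))),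
          ENNReal.ofReal (frobeniusNormSq (Gu z.1 z.2)) ≤ C) ∧
      AEStronglyMeasurable (uncurry p)
        (volume.restrict (parabolicCylinder R (0 : ℝ × (EuclideanSpace ℝ (Fin 3))))) ∧
      ∫⁻ z in parabolicCylinder R (0 : ℝ × (EuclideanSpace ℝ (Fin 3))), ‖p z.1 z.2‖ₑ ^ (3 / 2 : ℝ) ≤ Mp ∧
      Tendsto (fun j => eLpNorm (uncurry (V (σ j)) - uncurry u) 3
        (volume.restrict (parabolicCylinder R (0 : ℝ × (EuclideanSpace ℝ (Fin 3)))))) atTop (𝓝 0) ∧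
      ∀ g : ℝ × (EuclideanSpace ℝ (Fin 3)) → ℝ,
        MemLp g 3 (volume.restrict (parabolicCylinder R (0 : ℝ × (EuclideanSpace ℝ (Fin 3))))) →
        Tendsto (fun j => ∫ z in parabolicCylinder R (0 : ℝ × (EuclideanSpace ℝ (Fin 3))),
            P (σ j) z.1 z.2 * g z) atTop
          (𝓝 (∫ z in parabolicCylinder R (0 : ℝ × (EuclideanSpace ℝ (Fin 3))), p z.1 z.2 * g z)) := by
  set S : Set (ℝ × (EuclideanSpace ℝ (Fin 3))) := parabolicCylinder R (0 : ℝ × (EuclideanSpace ℝ (Fin 3)))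
    with hS
  set Ω : Opens (ℝ × (EuclideanSpace ℝ (Fin 3))) :=
    parabolicCylinderOpens R (0 : ℝ × (EuclideanSpace ℝ (Fin 3))) with hΩ
  have hΩS : ((Ω : Opens (ℝ × (EuclideanSpace ℝ (Fin 3)))) : Set (ℝ × (EuclideanSpace ℝ (Fin 3)))) = S := rfl
  have hSeq : S = Ioo (-R ^ 2) 0 ×ˢ ball (0 : EuclideanSpace ℝ (Fin 3)) R :=
    SuitableCompactness.parabolicCylinder_zero R
  have hSfin : volume S ≠ ∞ := SuitableCompactness.volume_parabolicCylinder_zero_ne_top R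
  haveI : IsFiniteMeasure (volume.restrict S) :=
    SuitableCompactness.isFiniteMeasure_restrict_parabolicCylinder_zero R
  have hCtop : ((C : ℝ≥0) : ℝ≥0∞) ≠ ∞ := ENNReal.coe_ne_top
  have hνabs : ∀ k, |ν k| ≤ 1 := fun k => by rw [abs_of_nonneg (hν0 k)]; exact hν1 k
  -- ## Step 1: the velocities (Aubin–Lions with the `ν`-uniform modulus)
  have hcyl : timeCylinder (⟨ball (0 : (EuclideanSpace ℝ (Fin 3))) R, isOpen_ball⟩ :
      Opens (EuclideanSpace ℝ (Fin 3))) (-R ^ 2) 0 = Ω := SuitableCompactness.timeCylinder_ball_eq R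
  have hsol : ∀ k, IsDistributionalNSSolutionOn (timeCylinder (⟨ball (0 : (EuclideanSpace ℝ (Fin 3))) R,
      isOpen_ball⟩ : Opens (EuclideanSpace ℝ (Fin 3))) (-R ^ 2) 0) (ν k) 0 (V k) (P k) := fun k => by
    rw [hcyl]; exact (hsw k).distributional
  have hGcyl : ∀ k, ∃ G : ℝ → (EuclideanSpace ℝ (Fin 3)) → (EuclideanSpace ℝ (Fin 3)) →L[ℝ]
      (EuclideanSpace ℝ (Fin 3)), HasWeakSpatialGradientOn (timeCylinder (⟨ball (0 : (EuclideanSpace ℝ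
        (Fin 3))) R, isOpen_ball⟩ : Opens (EuclideanSpace ℝ (Fin 3))) (-R ^ 2) 0) (V k) G ∧
      ∫⁻ z in Ioo (-R ^ 2) 0 ×ˢ ball (0 : (EuclideanSpace ℝ (Fin 3))) R,
        ENNReal.ofReal (frobeniusNormSq (G z.1 z.2)) ≤ (C : ℝ≥0∞) := fun k => by
    refine ⟨GV k, by rw [hcyl]; exact hG k, ?_⟩
    rw [← hSeq]; exact hGb k
  have hPcyl : ∀ k, ∫⁻ z in Ioo (-R ^ 2) 0 ×ˢ ball (0 : (EuclideanSpace ℝ (Fin 3))) R,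
      ‖P k z.1 z.2‖ₑ ^ (3 / 2 : ℝ) ≤ Mp := fun k => by rw [← hSeq]; exact hPb k
  obtain ⟨σ₁, u, hσ₁, hum', huE, hconv', -⟩ :=
    exists_subseq_strong_limit_velocity_visc_ball (0 : (EuclideanSpace ℝ (Fin 3))) R hνabs hCtop hCtop hMp
      hsol hE hGcyl hPcyl
  have hum : AEStronglyMeasurable (uncurry u) (volume.restrict S) := by rw [hSeq]; exact hum'
  have hconv : Tendsto (fun i => ∫⁻ z in S, ‖V (σ₁ i) z.1 z.2 - u z.1 z.2‖ₑ ^ 2) atTop (𝓝 0) := by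
    rw [hSeq]; exact hconv'
  -- ## Step 2: the pressures along `σ₁` (weak `L^{3/2}` compactness)
  have hPm : ∀ k, AEStronglyMeasurable (uncurry (P k)) (volume.restrict S) := fun k =>
    (hsw k).distributional.2.2.1.aestronglyMeasurable
  have hpq : (3 / 2 : ℝ).HolderConjugate 3 := Real.holderConjugate_iff.2 ⟨by norm_num, by norm_num⟩
  obtain ⟨σ₂, hσ₂, g, hgmem, hgb, hgw⟩ :=
    FunctionSpaces.exists_subseq_tendsto_integral_mul_of_lintegral_rpow_le'
      (μ := volume.restrict S) hpq (f := fun j => uncurry (P (σ₁ j))) (fun j => hPm _) hMp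
      (fun j => hPb _)
  set p : ℝ → (EuclideanSpace ℝ (Fin 3)) → ℝ := fun t x => g (t, x) with hp
  have hpg : uncurry p = g := by funext z; rfl
  have e3 : ENNReal.ofReal 3 = 3 := ENNReal.ofReal_ofNat 3
  set σ : ℕ → ℕ := fun j => σ₁ (σ₂ j) with hσdef
  have hσ : StrictMono σ := hσ₁.comp hσ₂
  have hπw : ∀ g' : ℝ × (EuclideanSpace ℝ (Fin 3)) → ℝ, MemLp g' 3 (volume.restrict S) →
      Tendsto (fun j => ∫ z in S, P (σ j) z.1 z.2 * g' z) atTop (𝓝 (∫ z in S, p z.1 z.2 * g' z)) :=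
    fun g' hg' => hgw g' (by rwa [e3])
  have hpm : AEStronglyMeasurable (uncurry p) (volume.restrict S) := by rw [hpg]; exact hgmem.1
  have hpb : ∫⁻ z in S, ‖p z.1 z.2‖ₑ ^ (3 / 2 : ℝ) ≤ Mp := hgb
  -- ## Step 3: the uniform `L^{10/3}` bound, `L³` convergence and the `L³` classes along `σ`
  have hVm : ∀ k, AEStronglyMeasurable (uncurry (V k)) (volume.restrict S) := fun k =>
    (hsw k).distributional.1.aestronglyMeasurable
  have hconvσ : Tendsto (fun j => ∫⁻ z in S, ‖V (σ j) z.1 z.2 - u z.1 z.2‖ₑ ^ 2) atTop (𝓝 0) :=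
    hconv.comp hσ₂.tendsto_atTop
  obtain ⟨M, hMtop, hM⟩ := SuitableCompactness.exists_tenThirds_bound hR C
  have h103 : ∀ k, ∫⁻ z in S, ‖V k z.1 z.2‖ₑ ^ (10 / 3 : ℝ) ≤ M := fun k =>
    hM (V k) (GV k) (hG k) (hE k) (hGb k)
  have hL3 : Tendsto (fun j => eLpNorm (uncurry (V (σ j)) - uncurry u) 3 (volume.restrict S)) atTop
      (𝓝 0) :=
    FunctionSpaces.tendsto_eLpNorm_three_of_sq_of_tenThirds (f := fun j => uncurry (V (σ j)))
      (g := uncurry u) (fun j => hVm _) hum hconvσ hMtop (fun j => h103 _)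
  have hu3 : MemLp (uncurry u) 3 (volume.restrict S) :=
    FunctionSpaces.memLp_three_limit_of_sq_of_tenThirds (f := fun j => uncurry (V (σ j)))
      (g := uncurry u) (fun j => hVm _) hum hconvσ hMtop (fun j => h103 _)
  have hv3 : ∀ k, MemLp (uncurry (V k)) 3 (volume.restrict S) := fun k =>
    FunctionSpaces.memLp_three_of_lintegral_tenThirds_le (hVm k) hMtop (h103 k)
  have hu1 : LocallyIntegrableOn (uncurry u)
      ((Ω : Opens (ℝ × (EuclideanSpace ℝ (Fin 3)))) : Set (ℝ × (EuclideanSpace ℝ (Fin 3)))) volume := by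
    rw [hΩS]
    have hi : IntegrableOn (uncurry u) S volume := hu3.integrable (by norm_num)
    exact hi.locallyIntegrableOn
  -- ## Step 4: a weak gradient of the limit with the bound `C`
  have h2S : Tendsto (fun j => eLpNorm (uncurry (V (σ j)) - uncurry u) 2 (volume.restrict S)) atTop
      (𝓝 0) :=
    FunctionSpaces.tendsto_eLpNorm_two_of_tendsto_lintegral_sq (f := fun j => uncurry (V (σ j)))
      (g := uncurry u) hconvσ
  have hconv1 : ∀ K ⊆ ((Ω : Opens (ℝ × (EuclideanSpace ℝ (Fin 3)))) : Set (ℝ × (EuclideanSpace ℝ (Fin 3)))),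
      IsCompact K → Tendsto (fun j => eLpNorm (fun z => uncurry (V (σ j)) z - uncurry u z) 1
        (volume.restrict K)) atTop (𝓝 0) := by
    intro K hKS hKc
    rw [hΩS] at hKS
    have hKfin : volume K ≠ ∞ := hKc.measure_lt_top.ne
    have hbound : ∀ j, eLpNorm (fun z => uncurry (V (σ j)) z - uncurry u z) 1 (volume.restrict K) ≤
        volume K ^ (1 / 2 : ℝ) * eLpNorm (uncurry (V (σ j)) - uncurry u) 2 (volume.restrict S) := by
      intro j
      have hm : AEStronglyMeasurable (uncurry (V (σ j)) - uncurry u) (volume.restrict K) :=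
        ((hVm _).sub hum).mono_measure (Measure.restrict_mono hKS le_rfl)
      calc eLpNorm (fun z => uncurry (V (σ j)) z - uncurry u z) 1 (volume.restrict K)
          = ∫⁻ z in K, ‖(uncurry (V (σ j)) - uncurry u) z‖ₑ := by
            rw [eLpNorm_one_eq_lintegral_enorm]; rfl
        _ ≤ (volume.restrict K) univ ^ (1 / 2 : ℝ) *
              eLpNorm (uncurry (V (σ j)) - uncurry u) 2 (volume.restrict K) :=
            lintegral_enorm_le_measure_univ_mul_eLpNorm_two hm
        _ ≤ volume K ^ (1 / 2 : ℝ) * eLpNorm (uncurry (V (σ j)) - uncurry u) 2 (volume.restrict S) := by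
            rw [Measure.restrict_apply_univ]
            gcongr
    have hlim : Tendsto (fun j => volume K ^ (1 / 2 : ℝ) *
        eLpNorm (uncurry (V (σ j)) - uncurry u) 2 (volume.restrict S)) atTop (𝓝 0) := by
      have h := ENNReal.Tendsto.const_mul h2S (a := volume K ^ (1 / 2 : ℝ))
        (Or.inr (ENNReal.rpow_ne_top_of_nonneg (by norm_num) hKfin))
      rwa [mul_zero] at h
    exact tendsto_of_tendsto_of_tendsto_of_le_of_le tendsto_const_nhds hlim (fun _ => zero_le) hbound
  obtain ⟨Gu, κ, hκ, hGuW, -, hGub, -, -, -⟩ :=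
    exists_hasWeakSpatialGradientOn_of_weakGradient_approx_L2 (Ω := Ω) (u := u) hu1
      (V := fun j => V (σ j)) (Gn := fun j => GV (σ j)) (fun j => hG _) hconv1 hCtop
      (fun j => by rw [hΩS]; exact hGb _)
  -- ## Step 5: the energy class of the limit in the indicator form
  have huEK : ∀ K ⊆ ((Ω : Opens (ℝ × (EuclideanSpace ℝ (Fin 3)))) : Set (ℝ × (EuclideanSpace ℝ (Fin 3)))),
      IsCompact K → ∃ C' : ℝ≥0, ∀ᵐ t : ℝ,
        ∫⁻ x, K.indicator (fun z : ℝ × (EuclideanSpace ℝ (Fin 3)) => ‖u z.1 z.2‖ₑ ^ 2) (t, x) ≤ C' := by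
    intro K hKS _hKc
    rw [hΩS] at hKS
    refine ⟨C, ?_⟩
    have h1 : ∀ᵐ t : ℝ, t ∈ Ioo (-R ^ 2) 0 →
        ∫⁻ x in ball (0 : (EuclideanSpace ℝ (Fin 3))) R, ‖u t x‖ₑ ^ 2 ≤ C :=
      (ae_restrict_iff' measurableSet_Ioo).1 huE
    filter_upwards [h1] with t ht
    by_cases htI : t ∈ Ioo (-R ^ 2) 0
    · calc ∫⁻ x, K.indicator (fun z : ℝ × (EuclideanSpace ℝ (Fin 3)) => ‖u z.1 z.2‖ₑ ^ 2) (t, x)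
          ≤ ∫⁻ x, (ball (0 : (EuclideanSpace ℝ (Fin 3))) R).indicator (fun x => ‖u t x‖ₑ ^ 2) x := by
            refine lintegral_mono fun x => ?_
            by_cases hx : (t, x) ∈ K
            · have hxB : x ∈ ball (0 : (EuclideanSpace ℝ (Fin 3))) R := by
                have h := hKS hx
                rw [hS, SuitableCompactness.mem_parabolicCylinder_zero] at h
                exact mem_ball_zero_iff.2 h.2
              rw [indicator_of_mem hx, indicator_of_mem hxB]
            · rw [indicator_of_notMem hx]
              exact zero_le
        _ = ∫⁻ x in ball (0 : (EuclideanSpace ℝ (Fin 3))) R, ‖u t x‖ₑ ^ 2 :=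
            lintegral_indicator measurableSet_ball _
        _ ≤ C := ht htI
    · have h0 : ∀ x, K.indicator (fun z : ℝ × (EuclideanSpace ℝ (Fin 3)) => ‖u z.1 z.2‖ₑ ^ 2) (t, x) = 0 :=
        fun x => indicator_of_notMem (fun hx => htI (by
          have h := hKS hx
          rw [hS, SuitableCompactness.mem_parabolicCylinder_zero] at h
          exact h.1)) _
      simp only [h0, lintegral_const, zero_mul]
      exact zero_le
  -- ## Step 6: suitability (Euler) of the limit along `σ ∘ κ`
  have hsuitu : IsSuitableWeakSolutionOn Ω 0 0 u p :=
    isSuitableWeakSolutionOn_of_tendsto_vanishingViscosity (Q := Ω) hSfin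
      (ν := fun j => ν (σ (κ j))) (fun j => hν0 _)
      ((hνlim.comp hσ.tendsto_atTop).comp hκ.tendsto_atTop)
      (v := fun j => V (σ (κ j))) (π := fun j => P (σ (κ j))) (G := fun j => GV (σ (κ j))) (u := u)
      (p := p) (Gu := Gu) (Cp := Mp) hMp (fun j => hsw _) (fun j => hG _) (fun j => hv3 _)
      (fun j => hPb _) hu3 hpm hpb hGuW (hGub.trans_lt ENNReal.coe_lt_top) huEK
      (hL3.comp hκ.tendsto_atTop) (fun g' hg' => (hπw g' hg').comp hκ.tendsto_atTop)
  exact ⟨σ, u, p, hσ, hsuitu, hum, hu3, huE, ⟨Gu, hGuW, hGub⟩, hpm, hpb, hL3, hπw⟩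

end Summit.NavierStokesRegularity.NavierStokesRegularity.Theorems.SereginZoomReduction
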